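import Literature.AlgebraicGeometry.Frobenioids.BaseSectionsOfObjects
import HarnessLib

/-!
# Frobenioids I, Corollary 5.7 (i): the predicate "`Ψ` maps `P₁` into `P₂`" (`PreFrobenioid.MapsInto`) —
# structural instance forms and the (negative) universal closure

Mochizuki, *The geometry of Frobenioids I: the general theory*, Kyushu J. Math. **62** (2008)
293–400, Cor. 5.7 (i) p. 108: "`Ψ` maps base-sections (respectively, quasi-base-Frobenius pairs) of `C₁` to
base-sections (respectively, quasi-base-Frobenius pairs) of `C₂`" [cite: MochizukiFrdI2008, Cor. 5.7 (i) p.108].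

PROOF-ONLY companion of `BaseSectionsOfObjects.lean` (statements, seat abc-iut-L1-t5), abc-iut cell, seat
abc-iut-f-023, FACT-LIST row F-0943 `MapsInto`. The declaration `PreFrobenioid.MapsInto Ψ P₁ P₂` is VOCABULARY —
the relation "`Ψ` carries the objects and the distinguished arrows of the subcategory `P₁ ⊆ C₁` into those of
`P₂ ⊆ C₂`" used to STATE Cor. 5.7 (i)/(iv) (`Cor57i_sections`, `Cor57i_pairs`, `Cor57iv`: "… `∃ P₂ …, MapsInto Ψ P₁ P₂`")
— not a claim of the paper. Accordingly:

* its universal closure is FALSE (`exists_not_mapsInto`, `not_forall_mapsInto`; closed witness over the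
  one-object discrete category, `exists_not_mapsInto_punit`: nothing is mapped into the EMPTY presection), so the
  row is a SCHEMA whose instance forms are the `MapsInto` conjuncts PRODUCED by the proofs of Cor. 5.7 (i)/(iv)
  (`cor57i_pairs_core`, `cor57i_sections_holds_of_isOfFSMType`, …), never a hypothesis;
* the structural instance forms that do hold for every presection: the identity maps `P` into `P`
  (`mapsInto_refl`) and "maps into" composes along composite equivalences (`MapsInto.trans`).

This refutes nothing in print (the paper asserts `MapsInto` only for the IMAGE base-section, which the tree
proves); no statement of the paper is restated or strengthened; no new definition; nothing here is specific to
the abc programme or bears on [IUTchIII] Cor. 3.12.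
-/

namespace Literature.AlgebraicGeometry.Frobenioids

open CategoryTheory

universe v' u'

namespace PreFrobenioid

section MapsIntoSchema

variable {C₁ : Type u'} [Category.{v'} C₁] {C₂ : Type u'} [Category.{v'} C₂] {C₃ : Type u'} [Category.{v'} C₃]

/-! ### Structural instance forms -/

/-- The identity equivalence maps every presection `P` into itself (instance form of "`Ψ` maps `P₁` into
`P₂`", Cor. 5.7 (i) p. 108, at `Ψ = id`). [cite: MochizukiFrdI2008, Cor. 5.7 (i) p.108] -/
theorem mapsInto_refl (P : Presection C₁) : MapsInto (CategoryTheory.Equivalence.refl (C := C₁)) P P :=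
  ⟨fun _ hA => hA, fun _ _ _ hf => hf⟩

/-- "Maps into" composes: if `Ψ` maps `P₁` into `P₂` and `Ψ'` maps `P₂` into `P₃`, then `Ψ' ∘ Ψ` maps `P₁` into
`P₃` (instance form of Cor. 5.7 (i) p. 108 along a composite equivalence). [cite: MochizukiFrdI2008, Cor. 5.7 (i) p.108] -/
theorem MapsInto.trans {Ψ : C₁ ≌ C₂} {Ψ' : C₂ ≌ C₃} {P₁ : Presection C₁} {P₂ : Presection C₂}
    {P₃ : Presection C₃} (h : MapsInto Ψ P₁ P₂) (h' : MapsInto Ψ' P₂ P₃) : MapsInto (Ψ.trans Ψ') P₁ P₃ :=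
  ⟨fun A hA => h'.1 _ (h.1 A hA), fun _ _ f hf => h'.2 _ (h.2 f hf)⟩

/-- The objects clause of "`Ψ` maps `P₁` into `P₂`": an object of `P₁` goes to an object of `P₂`.
[cite: MochizukiFrdI2008, Cor. 5.7 (i) p.108] -/
theorem MapsInto.obj_mem {Ψ : C₁ ≌ C₂} {P₁ : Presection C₁} {P₂ : Presection C₂} (h : MapsInto Ψ P₁ P₂)
    {A : C₁} (hA : P₁.obj A) : P₂.obj (Ψ.functor.obj A) :=
  h.1 A hA

/-- The arrows clause of "`Ψ` maps `P₁` into `P₂`": a distinguished arrow of `P₁` goes to one of `P₂`.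
[cite: MochizukiFrdI2008, Cor. 5.7 (i) p.108] -/
theorem MapsInto.hom_mem {Ψ : C₁ ≌ C₂} {P₁ : Presection C₁} {P₂ : Presection C₂} (h : MapsInto Ψ P₁ P₂)
    {A B : C₁} {f : A ⟶ B} (hf : P₁.hom f) : P₂.hom (Ψ.functor.map f) :=
  h.2 f hf

/-! ### The universal closure is false (the row is a schema, not a fact) -/

/-- **The universal closure of `MapsInto` fails**: over a category with an object, no equivalence maps the FULL
presection (all objects, all arrows) into the EMPTY presection (no objects, no arrows) — explicit witnesses.
`MapsInto` is the vocabulary of Cor. 5.7 (i), asserted in print — and proved in the tree — only for the image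
base-section. [cite: MochizukiFrdI2008, Cor. 5.7 (i) p.108] -/
theorem exists_not_mapsInto [Nonempty C₁] (Ψ : C₁ ≌ C₂) :
    ∃ (P₁ : Presection C₁) (P₂ : Presection C₂), ¬ MapsInto Ψ P₁ P₂ := by
  obtain ⟨A⟩ := ‹Nonempty C₁›
  exact
    ⟨{ obj := fun _ => True
       hom := fun _ => True
       obj_of_hom := fun _ _ => ⟨trivial, trivial⟩
       hom_id := fun _ => trivial
       hom_comp := fun _ _ _ _ => trivial },
     { obj := fun _ => False
       hom := fun _ => False
       obj_of_hom := fun _ h => h.elim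
       hom_id := fun h => h.elim
       hom_comp := fun _ _ h _ => h.elim },
     fun h => h.1 A trivial⟩

/-- Negated-universal form of `exists_not_mapsInto`: it is NOT the case that every equivalence maps every
presection into every presection (the universal closure of the predicate `MapsInto` is false; the row is a
schema whose instances are produced, not assumed). [cite: MochizukiFrdI2008, Cor. 5.7 (i) p.108] -/
theorem not_forall_mapsInto [Nonempty C₁] (Ψ : C₁ ≌ C₂) :
    ¬ ∀ (P₁ : Presection C₁) (P₂ : Presection C₂), MapsInto Ψ P₁ P₂ := fun h => by
  obtain ⟨P₁, P₂, hn⟩ := exists_not_mapsInto Ψ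
  exact hn (h P₁ P₂)

/-- Closed witness: over the one-object discrete category, the identity equivalence does not map the full
presection into the empty one — `∃ P₁ P₂, ¬ MapsInto (𝟭) P₁ P₂` with no free variables.
[cite: MochizukiFrdI2008, Cor. 5.7 (i) p.108] -/
theorem exists_not_mapsInto_punit :
    ∃ (P₁ P₂ : Presection (Discrete PUnit.{1})),
      ¬ MapsInto (CategoryTheory.Equivalence.refl (C := Discrete PUnit.{1})) P₁ P₂ :=
  exists_not_mapsInto (C₁ := Discrete PUnit.{1}) (CategoryTheory.Equivalence.refl (C := Discrete PUnit.{1}))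

end MapsIntoSchema

end PreFrobenioid

end Literature.AlgebraicGeometry.Frobenioids
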